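import Mathlib
import HarnessLib
import Summits.AtomisticToContinuum.FouriersLaw.Theorems.VanishingNoiseTransferNoisyFourierAbelThomsonBath
import Summits.AtomisticToContinuum.FouriersLaw.Theorems.VanishingNoiseTransferNoisyFourierThomsonWitnessPairing
import Summits.AtomisticToContinuum.FouriersLaw.Theorems.VanishingNoiseTransferNoisyFourierThomsonWitnessCostsLiouvillian

/-!
# The `s`-uniform Thomson floor (A7) from the Thomson witness, given its `O(L)` costs
(line `abel-storage-decay` / `abel-kapitza-even-corrector`, crux `VanishingNoiseTransfer.NoisyFourier`,
stmt-AtomisticToContinuum-11977, stub A7 `stub_thomsonFloor`; lead c7)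

`--supports stmt-AtomisticToContinuum-11977` file. Setting as in `…ThomsonWitnessPairing`: the pinned anharmonic chain
`𝐏 = pinnedChain ω₂ lam β γ` (parameters `> 0`), `T > 0`, flips at rate `ε > 0`, Gibbs measure `μ_T`, total current `J`,
classical Abel correctors `u` at `s > 0` (`L_ε u = s u − J`), the pairing `σ_L(s) = ∫ J u dμ_T`, and the lead's Thomson witness
`v = Σ_k (X_{k+1} − X_k)(p_k p_{k+1}/V''(r_k))` (explicit text as in the whole project).

* `thomsonFloor_of_costs` — IF the witness has `O(L)` costs with one constant `c₂` (square-integrability of `v, Xv, L_{T,T}v`;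
  `∫v², Σ_m∫(v∘F_m − v)², Σ_m B_m∫(∂_{p_m}v)², ∫(Xv)² ≤ c₂(L−1)`; this is the deliverable of the cost files of the project),
  THEN the registered stub A7 holds verbatim: there are `c > 0`, `L₀` with `c(L−1) ≤ σ_L(s)` for all `L ≥ L₀`, `L ≥ 2`,
  `s ∈ (0,1]` and every classical corrector. Proof: the bath-refined Thomson bound `abelThomsonBath_sq` (p160222) with
  `a = 1`, `b = −1` — the pattern identity `P₀(Xv) = p_0² − p_{L−1}² = (p_0² − T) − (p_{L−1}² − T)`
  (`patternAvg_liouvillian_thomsonWitness`, p161006) makes the pattern defect a pure BATH term, charged to the corrector's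
  bath dissipation at cost `2T²/γ` instead of `4T²/s` — the pairing `∫ vJ = (L−1)T²` (p161490), `∫(Xv − h)² ≤ 2∫(Xv)² + 2∫h²`
  with `∫ h² = 4T²`, and real arithmetic (`floor_of_sq_le`): `σ_L(s) ≥ (L−1)T⁴/(4C)` once `L − 1 ≥ C'/C`.

So the bulk Abel–Green–Kubo conductivity of the velocity-flip chain is bounded below uniformly in `L` AND `s` — a
Green–Kubo floor for flips alone (Bernardin–Olla 2011 §6.2 had none). References: Bernardin–Olla 2011 §§5–6; folklore.
No definitions; standard axioms.
-/

noncomputable section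

open MeasureTheory Filter Topology
open scoped BigOperators
open Literature.MathematicalPhysics.KineticTheory.HeatConduction
open Summit.AtomisticToContinuum.FouriersLaw.Theorems.NoisyFourier.AbelThomson (abelThomsonBath_sq)
open Summit.AtomisticToContinuum.FouriersLaw.Theorems.NoisyFourier.ThomsonWitness.Algebra
  (contDiff_two_thomsonWitness patternAvg_liouvillian_thomsonWitness)
open Summit.AtomisticToContinuum.FouriersLaw.Theorems.NoisyFourier.ThomsonWitness.Pairing
  (integral_thomsonWitness_mul_totalCurrent)
open Summit.AtomisticToContinuum.FouriersLaw.Theorems.NoisyFourier.ThomsonWitness.Moments (integral_sq_sub_sq_sq)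
open Summit.AtomisticToContinuum.FouriersLaw.Theorems.NoisyFourier.ThomsonWitness.Costs (memLp_h0)

namespace Summit.AtomisticToContinuum.FouriersLaw.Theorems.NoisyFourier.ThomsonWitness.Floor

/-! ## Real arithmetic -/

/-- From the squared Thomson bound `(N T²)² ≤ 2 σ Q` with cost `0 ≤ Q ≤ 2 C N` (`N, C, T > 0`): `N T⁴/(4C) ≤ σ`.
[folklore] -/
theorem floor_of_sq_le {σ Q C N T : ℝ} (hN : 0 < N) (hC : 0 < C) (hT : 0 < T) (hQ0 : 0 ≤ Q)
    (hQ : Q ≤ 2 * C * N) (h : (N * T ^ 2) ^ 2 ≤ 2 * σ * Q) : N * T ^ 4 / (4 * C) ≤ σ := by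
  have hA : 0 < (N * T ^ 2) ^ 2 := by positivity
  have hQpos : 0 < Q := by
    rcases hQ0.lt_or_eq with hq | hq
    · exact hq
    · exfalso; rw [← hq] at h; linarith
  have hσQ : (N * T ^ 2) ^ 2 / (2 * Q) ≤ σ := by
    rw [div_le_iff₀ (by positivity)]; linarith
  have hcmp : N * T ^ 4 / (4 * C) ≤ (N * T ^ 2) ^ 2 / (2 * Q) := by
    rw [div_le_div_iff₀ (by positivity) (by positivity)]
    have : N * T ^ 4 * (2 * Q) ≤ N * T ^ 4 * (4 * C * N) := by
      apply mul_le_mul_of_nonneg_left _ (by positivity); linarith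
    nlinarith [this]
  exact hcmp.trans hσQ

variable {ω₂ lam β γ : ℝ}

/-- **A7 from the witness costs.** See the file header. [folklore] -/
theorem thomsonFloor_of_costs (hω : 0 < ω₂) (hl : 0 < lam) (hβ : 0 < β) (hγ : 0 < γ) {T : ℝ} (hT : 0 < T)
    {ε : ℝ} (hε : 0 < ε)
    (hcost : ∃ c₂ : ℝ, ∀ (L : ℕ), 2 ≤ L →
      let P := pinnedChain ω₂ lam β γ
      let v : PhaseSpace L → ℝ := fun x => ∑ i : Fin L, ∑ j : Fin L, if j.val = i.val + 1 then
        (x.2 i * (x.2 j ^ 2 * (-(6 * β * (x.1 j - x.1 i)) / (1 + 3 * β * (x.1 j - x.1 i) ^ 2) ^ 2) -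
            partialQ j (P.hamiltonian L) x * (1 / (1 + 3 * β * (x.1 j - x.1 i) ^ 2))) +
          x.2 j * (x.2 i ^ 2 * (-(6 * β * (x.1 j - x.1 i)) / (1 + 3 * β * (x.1 j - x.1 i) ^ 2) ^ 2) +
            partialQ i (P.hamiltonian L) x * (1 / (1 + 3 * β * (x.1 j - x.1 i) ^ 2))))
        else 0
      MemLp v 2 (P.gibbsMeasure L T) ∧ MemLp (P.liouvillian L v) 2 (P.gibbsMeasure L T) ∧
        MemLp (P.generator L T T v) 2 (P.gibbsMeasure L T) ∧
        ∫ x, v x ^ 2 ∂(P.gibbsMeasure L T) ≤ c₂ * ((L : ℝ) - 1) ∧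
        ∑ i : Fin L, ∫ x, (v (momentumFlip i x) - v x) ^ 2 ∂(P.gibbsMeasure L T) ≤ c₂ * ((L : ℝ) - 1) ∧
        ∑ i : Fin L, OscillatorChain.bathWeight L i * ∫ x, (partialP i v x) ^ 2 ∂(P.gibbsMeasure L T) ≤ c₂ * ((L : ℝ) - 1) ∧
        ∫ x, (P.liouvillian L v x) ^ 2 ∂(P.gibbsMeasure L T) ≤ c₂ * ((L : ℝ) - 1)) :
    ∃ c : ℝ, 0 < c ∧ ∃ L₀ : ℕ, ∀ (L : ℕ), L₀ ≤ L → 2 ≤ L → ∀ s : ℝ, 0 < s → s ≤ 1 →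
      ∀ u : PhaseSpace L → ℝ,
        (ContDiff ℝ 2 u ∧ MemLp u 2 ((pinnedChain ω₂ lam β γ).gibbsMeasure L T) ∧
          ∀ x, (pinnedChain ω₂ lam β γ).flipGenerator L T T ε u x =
            s * u x - ∑ i : Fin L, (pinnedChain ω₂ lam β γ).bondCurrent L i x) →
        c * ((L : ℝ) - 1) ≤ ∫ x, (∑ i : Fin L, (pinnedChain ω₂ lam β γ).bondCurrent L i x) * u x
          ∂((pinnedChain ω₂ lam β γ).gibbsMeasure L T) := by
  obtain ⟨c₂, hc₂⟩ := hcost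
  set P := pinnedChain ω₂ lam β γ with hP
  -- one constant for all four costs; `C` multiplies `(L - 1)` in the total Thomson cost, `C'` is the constant part
  set c := max c₂ 1 with hcdef
  have hc1 : 1 ≤ c := le_max_right _ _
  have hc0 : 0 < c := by linarith
  have hcc : c₂ ≤ c := le_max_left _ _
  set C : ℝ := c * (1 + ε / 2 + γ * T + 2 / ε) with hCdef
  have hC0 : 0 < C := by positivity
  set C' : ℝ := 2 / ε * (4 * T ^ 2) + 1 / γ * (2 * T ^ 2) with hC'def
  have hC'0 : 0 ≤ C' := by positivity
  refine ⟨T ^ 4 / (4 * C), by positivity, ⌈C' / C⌉₊ + 2, fun L hL0 hL2 s hs hs1 u hu => ?_⟩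
  obtain ⟨huC, hu2, hupde⟩ := hu
  have hN : (1 : ℝ) ≤ (L : ℝ) - 1 := by
    have : (2 : ℝ) ≤ L := by exact_mod_cast hL2
    linarith
  have hN0 : 0 < (L : ℝ) - 1 := by linarith
  -- `C' ≤ C (L - 1)` from `L ≥ ⌈C'/C⌉ + 2`
  have hC'le : C' ≤ C * ((L : ℝ) - 1) := by
    have h1 : C' / C ≤ ⌈C' / C⌉₊ := Nat.le_ceil _
    have h2 : ((⌈C' / C⌉₊ + 2 : ℕ) : ℝ) ≤ L := by exact_mod_cast hL0
    push_cast at h2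
    have h3 : C' / C ≤ (L : ℝ) - 1 := by linarith
    rwa [div_le_iff₀ hC0, mul_comm] at h3
  -- the witness data at this `L`; abbreviate the witness
  obtain ⟨hv2, hXv2, hGv2, hW, hE, hD, hX⟩ := hc₂ L hL2
  set V : PhaseSpace L → ℝ := (fun y : PhaseSpace L => ∑ i : Fin L, ∑ j : Fin L, if j.val = i.val + 1 then
        (y.2 i * (y.2 j ^ 2 * (-(6 * β * (y.1 j - y.1 i)) / (1 + 3 * β * (y.1 j - y.1 i) ^ 2) ^ 2) -
            partialQ j (P.hamiltonian L) y * (1 / (1 + 3 * β * (y.1 j - y.1 i) ^ 2))) +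
          y.2 j * (y.2 i ^ 2 * (-(6 * β * (y.1 j - y.1 i)) / (1 + 3 * β * (y.1 j - y.1 i) ^ 2) ^ 2) +
            partialQ i (P.hamiltonian L) y * (1 / (1 + 3 * β * (y.1 j - y.1 i) ^ 2))))
        else 0) with hVdef
  set i0 : Fin L := ⟨0, by omega⟩ with hi0
  set iL : Fin L := ⟨L - 1, by omega⟩ with hiL
  -- Thomson bound with the bath-valued pattern defect `a = 1`, `b = -1`
  have hdef : ∀ x : PhaseSpace L, (∑ σ : Fin L → Bool, P.liouvillian L V (x.1, fun i => if σ i then -x.2 i else x.2 i)) / 2 ^ L =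
      1 * (x.2 i0 ^ 2 - T) + (-1) * (x.2 iL ^ 2 - T) := by
    intro x
    rw [hVdef, patternAvg_liouvillian_thomsonWitness (ω₂ := ω₂) (lam := lam) (γ := γ) hβ.le hL2 x]
    ring
  have hTh := abelThomsonBath_sq hω hl hβ hγ hT hε hL2 i0 iL rfl rfl hs huC hu2 hupde
    (hVdef ▸ contDiff_two_thomsonWitness (L := L) hβ.le) hv2 hXv2 hGv2 1 (-1) hdef
  -- the pairing
  have hA : ∫ x, V x * (∑ i : Fin L, P.bondCurrent L i x) ∂(P.gibbsMeasure L T) = ((L : ℝ) - 1) * T ^ 2 := by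
    have := integral_thomsonWitness_mul_totalCurrent (γ := γ) hω hl hβ hγ hT hL2 (hVdef ▸ hv2) (hVdef ▸ hXv2)
      (hVdef ▸ hGv2)
    rw [hVdef]; exact this
  rw [hA] at hTh
  -- the bath-defect part of the cost: `∫ (XV - h)² ≤ 2 ∫ (XV)² + 2 ∫ h²`, `∫ h² = 4 T²`
  have h0L : i0 ≠ iL := by
    intro h; have := congrArg Fin.val h; simp only [hi0, hiL] at this; omega
  have hh : ∫ x, (1 * (x.2 i0 ^ 2 - T) + (-1) * (x.2 iL ^ 2 - T)) ^ 2 ∂(P.gibbsMeasure L T) = 4 * T ^ 2 := by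
    rw [← integral_sq_sub_sq_sq hω hl.le hβ.le γ hT L h0L]
    refine integral_congr_ae (Filter.Eventually.of_forall fun x => ?_)
    dsimp only; ring
  have hh2 : MemLp (fun x : PhaseSpace L => 1 * (x.2 i0 ^ 2 - T) + (-1) * (x.2 iL ^ 2 - T)) 2 (P.gibbsMeasure L T) :=
    (memLp_h0 hω hl.le hβ.le γ hT L i0 iL).ae_eq (Filter.Eventually.of_forall fun x => by ring)
  have hsq : ∀ a b : ℝ, (a - b) ^ 2 ≤ 2 * a ^ 2 + 2 * b ^ 2 := fun a b => by nlinarith [sq_nonneg (a + b)]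
  have hXh : ∫ x, (P.liouvillian L V x - (1 * (x.2 i0 ^ 2 - T) + (-1) * (x.2 iL ^ 2 - T))) ^ 2 ∂(P.gibbsMeasure L T) ≤
      2 * (c₂ * ((L : ℝ) - 1)) + 2 * (4 * T ^ 2) := by
    have hi1 := hXv2.integrable_sq
    have hi2 := hh2.integrable_sq
    rw [← hh]
    calc _ ≤ ∫ x, (2 * (P.liouvillian L V x) ^ 2 + 2 * (1 * (x.2 i0 ^ 2 - T) + (-1) * (x.2 iL ^ 2 - T)) ^ 2)
          ∂(P.gibbsMeasure L T) := by
          refine integral_mono ((hXv2.sub hh2).integrable_sq) ((hi1.const_mul 2).add (hi2.const_mul 2)) fun x => ?_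
          exact hsq _ _
      _ = 2 * ∫ x, (P.liouvillian L V x) ^ 2 ∂(P.gibbsMeasure L T) +
          2 * ∫ x, (1 * (x.2 i0 ^ 2 - T) + (-1) * (x.2 iL ^ 2 - T)) ^ 2 ∂(P.gibbsMeasure L T) := by
          rw [integral_add (hi1.const_mul 2) (hi2.const_mul 2), integral_const_mul, integral_const_mul]
      _ ≤ _ := by nlinarith [hX]
  -- the arithmetic
  have key : ∀ {σ W E D Xh : ℝ}, 0 ≤ W → 0 ≤ E → 0 ≤ D → 0 ≤ Xh → W ≤ c₂ * ((L : ℝ) - 1) →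
      E ≤ c₂ * ((L : ℝ) - 1) → D ≤ c₂ * ((L : ℝ) - 1) → Xh ≤ 2 * (c₂ * ((L : ℝ) - 1)) + 2 * (4 * T ^ 2) →
      (((L : ℝ) - 1) * T ^ 2) ^ 2 ≤ 2 * σ * (s * W + ε / 2 * E + γ * T * D + 1 / ε * Xh +
        1 / γ * (((1 : ℝ) ^ 2 + (-1) ^ 2) * T ^ 2)) → T ^ 4 / (4 * C) * ((L : ℝ) - 1) ≤ σ := by
    intro σ W E D Xh hW0 hE0 hD0 hXh0 hW' hE' hD' hXh' hTh'
    have hQ0 : 0 ≤ s * W + ε / 2 * E + γ * T * D + 1 / ε * Xh + 1 / γ * (((1 : ℝ) ^ 2 + (-1) ^ 2) * T ^ 2) := by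
      positivity
    have hcN : c₂ * ((L : ℝ) - 1) ≤ c * ((L : ℝ) - 1) := mul_le_mul_of_nonneg_right hcc hN0.le
    have hWc : W ≤ c * ((L : ℝ) - 1) := hW'.trans hcN
    have hEc : E ≤ c * ((L : ℝ) - 1) := hE'.trans hcN
    have hDc : D ≤ c * ((L : ℝ) - 1) := hD'.trans hcN
    have hXc : Xh ≤ 2 * (c * ((L : ℝ) - 1)) + 2 * (4 * T ^ 2) := by linarith [hXh', hcN]
    have hQ : s * W + ε / 2 * E + γ * T * D + 1 / ε * Xh + 1 / γ * (((1 : ℝ) ^ 2 + (-1) ^ 2) * T ^ 2) ≤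
        C * ((L : ℝ) - 1) + C' := by
      have h1 : s * W ≤ c * ((L : ℝ) - 1) := by
        have h1a := mul_le_mul_of_nonneg_left hWc hs.le
        have h1b : s * (c * ((L : ℝ) - 1)) ≤ 1 * (c * ((L : ℝ) - 1)) :=
          mul_le_mul_of_nonneg_right hs1 (by positivity)
        linarith
      have h2 : ε / 2 * E ≤ ε / 2 * (c * ((L : ℝ) - 1)) := mul_le_mul_of_nonneg_left hEc (by positivity)
      have h3 : γ * T * D ≤ γ * T * (c * ((L : ℝ) - 1)) := mul_le_mul_of_nonneg_left hDc (by positivity)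
      have h4 : 1 / ε * Xh ≤ 1 / ε * (2 * (c * ((L : ℝ) - 1)) + 2 * (4 * T ^ 2)) :=
        mul_le_mul_of_nonneg_left hXc (by positivity)
      have e : C * ((L : ℝ) - 1) + C' = c * ((L : ℝ) - 1) + ε / 2 * (c * ((L : ℝ) - 1)) +
          γ * T * (c * ((L : ℝ) - 1)) + 1 / ε * (2 * (c * ((L : ℝ) - 1)) + 2 * (4 * T ^ 2)) +
          1 / γ * (((1 : ℝ) ^ 2 + (-1) ^ 2) * T ^ 2) := by
        rw [hCdef, hC'def]; ring
      rw [e]; linarith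
    have hQ2 : s * W + ε / 2 * E + γ * T * D + 1 / ε * Xh + 1 / γ * (((1 : ℝ) ^ 2 + (-1) ^ 2) * T ^ 2) ≤
        2 * C * ((L : ℝ) - 1) := by linarith
    have := floor_of_sq_le hN0 hC0 hT hQ0 hQ2 hTh'
    calc T ^ 4 / (4 * C) * ((L : ℝ) - 1) = ((L : ℝ) - 1) * T ^ 4 / (4 * C) := by ring
      _ ≤ σ := this
  exact key (integral_nonneg fun x => sq_nonneg _)
    (Finset.sum_nonneg fun i _ => integral_nonneg fun x => sq_nonneg _)
    (Finset.sum_nonneg fun i _ => mul_nonneg (bathWeight_nonneg L i) (integral_nonneg fun x => sq_nonneg _))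
    (integral_nonneg fun x => sq_nonneg _) hW hE hD hXh hTh

/-- **Registered helper `helper_thomsonFloorOfCosts`** of stmt-AtomisticToContinuum-11977 (lead c7; Thomson-witness project, stub
A7 `stub_thomsonFloor`): `thomsonFloor_of_costs`, fully quantified and notation-free (witness spelled with `let`
abbreviations; definitionally the same function). [folklore] -/
theorem helper_thomsonFloorOfCosts : ∀ (ω₂ lam β γ T ε : ℝ), 0 < ω₂ → 0 < lam → 0 < β → 0 < γ → 0 < T → 0 < ε → (∃ c₂ : ℝ, ∀ (L : ℕ), 2 ≤ L → let v : Literature.MathematicalPhysics.KineticTheory.HeatConduction.PhaseSpace L → ℝ := (fun x : Literature.MathematicalPhysics.KineticTheory.HeatConduction.PhaseSpace L => ∑ i : Fin L, ∑ j : Fin L, if j.val = i.val + 1 then (let r := x.1 j - x.1 i; let φ := 1 / (1 + 3 * β * r ^ 2); let dφ := -(6 * β * r) / (1 + 3 * β * r ^ 2) ^ 2; x.2 i * (x.2 j ^ 2 * dφ - Literature.MathematicalPhysics.KineticTheory.HeatConduction.partialQ j ((Literature.MathematicalPhysics.KineticTheory.HeatConduction.pinnedChain ω₂ lam β γ).hamiltonian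 L) x * φ) + x.2 j * (x.2 i ^ 2 * dφ + Literature.MathematicalPhysics.KineticTheory.HeatConduction.partialQ i ((Literature.MathematicalPhysics.KineticTheory.HeatConduction.pinnedChain ω₂ lam β γ).hamiltonian L) x * φ)) else 0); MeasureTheory.MemLp v 2 ((Literature.MathematicalPhysics.KineticTheory.HeatConduction.pinnedChain ω₂ lam β γ).gibbsMeasure L T) ∧ MeasureTheory.MemLp ((Literature.MathematicalPhysics.KineticTheory.HeatConduction.pinnedChain ω₂ lam β γ).liouvillian L v) 2 ((Literature.MathematicalPhysics.KineticTheory.HeatConduction.pinnedChain ω₂ lam β γ).gibbsMeasure L T) ∧ MeasureTheory.MemLp ((Literature.MathematicalPhysics.KineticTheory.HeatConduction.pinnedChain ω₂ lam β γ).generator L T T v) 2 ((Literature.MathematicalPhysics.KineticTheory.HeatConduction.pinnedChain ω₂ lam β γ).gibbsMeasure L T) ∧ MeasureTheory.integral ((Literature.MathematicalPhysics.KineticTheory.HeatConduction.pinnedChain ω₂ lam β γ).gibbsMeasure L T) (fun x => v x ^ 2) ≤ c₂ * ((L : ℝ) - 1) ∧ ∑ i : Fin L, MeasureTheory.integral ((Literature.MathematicalPhysics.KineticTheory.HeatConduction.pinnedChain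 ω₂ lam β γ).gibbsMeasure L T) (fun x => (v (Literature.MathematicalPhysics.KineticTheory.HeatConduction.momentumFlip i x) - v x) ^ 2) ≤ c₂ * ((L : ℝ) - 1) ∧ ∑ i : Fin L, Literature.MathematicalPhysics.KineticTheory.HeatConduction.OscillatorChain.bathWeight L i * MeasureTheory.integral ((Literature.MathematicalPhysics.KineticTheory.HeatConduction.pinnedChain ω₂ lam β γ).gibbsMeasure L T) (fun x => (Literature.MathematicalPhysics.KineticTheory.HeatConduction.partialP i v x) ^ 2) ≤ c₂ * ((L : ℝ) - 1) ∧ MeasureTheory.integral ((Literature.MathematicalPhysics.KineticTheory.HeatConduction.pinnedChain ω₂ lam β γ).gibbsMeasure L T) (fun x => ((Literature.MathematicalPhysics.KineticTheory.HeatConduction.pinnedChain ω₂ lam β γ).liouvillian L v x) ^ 2) ≤ c₂ * ((L : ℝ) - 1)) → ∃ c : ℝ, 0 < c ∧ ∃ L₀ : ℕ, ∀ (L : ℕ), L₀ ≤ L → 2 ≤ L → ∀ s : ℝ, 0 < s → s ≤ 1 → ∀ u : Literature.MathematicalPhysics.KineticTheory.HeatConduction.PhaseSpace L → ℝ, (ContDiff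 ℝ 2 u ∧ MeasureTheory.MemLp u 2 ((Literature.MathematicalPhysics.KineticTheory.HeatConduction.pinnedChain ω₂ lam β γ).gibbsMeasure L T) ∧ ∀ x, (Literature.MathematicalPhysics.KineticTheory.HeatConduction.pinnedChain ω₂ lam β γ).flipGenerator L T T ε u x = s * u x - ∑ i : Fin L, (Literature.MathematicalPhysics.KineticTheory.HeatConduction.pinnedChain ω₂ lam β γ).bondCurrent L i x) → c * ((L : ℝ) - 1) ≤ MeasureTheory.integral ((Literature.MathematicalPhysics.KineticTheory.HeatConduction.pinnedChain ω₂ lam β γ).gibbsMeasure L T) (fun x => (∑ i : Fin L, (Literature.MathematicalPhysics.KineticTheory.HeatConduction.pinnedChain ω₂ lam β γ).bondCurrent L i x) * u x) :=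
  fun _ _ _ γ _ _ hω hl hβ hγ hT hε hcost => thomsonFloor_of_costs (γ := γ) hω hl hβ hγ hT hε hcost

end Summit.AtomisticToContinuum.FouriersLaw.Theorems.NoisyFourier.ThomsonWitness.Floor

end
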